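import Mathlib
import HarnessLib

/-!
# Venture HSemireg — identity-class rigidity at amplitude four

HONEST FRAMING. Lean leaf for the computation cell `pub-hsemireg` (theory seat th-3 gen 41; note of
record `run/shared/lean/pub/pub-hsemireg/theory/TH3-IDENTITY-RIGIDITY.md`, 2026-08-26). In the
minimal twisted-complex model of a four-level «reduced-point complex» (levels `M₀ … M₃`, three odd
gluing operators `u_a` of degree `+1`) a Killing class of IDENTITY TYPE `B = s ⊗ Id` (relation (E1)
`u_l V_j + V_j u_l = ε_{jls} Id`) hands over two degree `−1` operators `ι₁, ι₂` with the
CAR-type relations `{u_a, ι_c} = δ_{ac} Id` (`a = 1,2,3`, `c = 1,2`). THIS FILE kernel-checks the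
purely algebraic consequence, written out on the four level spaces as linear maps between separate
modules: such relations force the pencil to be FLAT, `{u_a, u_b} = 0` for all `a, b` (and indeed
`u_a ∘ u_a = 0`), at amplitude four. The statement is proved in a master form for two further odd
operators `p, q` whose anticommutators with `ι₁, ι₂` are arbitrary SCALARS (`x = u₁` is the case
`(1,0)`, `y = u₂` the case `(0,1)`, any other direction the case `(0,0)`). The lemma is SHARP in the
amplitude: at five levels `Λ(k²) ⊗̂ k[y]/y³` (dims `(1,3,4,3,1)`, `u₁, u₂` the two wedges, `u₃ = y`
with the Koszul sign) carries the identity-type class `e₃ ⊗ Id` and is curved (`u₃² = y² ≠ 0`) — the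
proof below uses that degree-`+2` operators vanish on `M2` and degree-`−1` operators vanish on `M0`.
A last theorem records the companion fact over a field: one contraction (`{v, a} = Id` on four
finite-dimensional levels) forces the Euler characteristic `dim N0 − dim N1 + dim N2 − dim N3` to
vanish (the supertrace of the relation), so the scalar part of a triple product on such a block
contributes nothing to its supertrace. The model, the classes and the consequence «(W³) holds on
such configurations by the flat-stratum theorem» are NOT formalised here; no object on an abelian
variety is constructed; nothing here bears on HC, HC_CM or HC_AV.
-/

namespace Summit.Ventures.HSemireg.IdentityClassRigidity

open LinearMap

variable {R : Type*} [CommRing R]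
variable {M0 M1 M2 M3 : Type*} [AddCommGroup M0] [Module R M0] [AddCommGroup M1] [Module R M1]
  [AddCommGroup M2] [Module R M2] [AddCommGroup M3] [Module R M3]

/-- **Master lemma, upper block.** Data: the level-0∕1 components `x0, x1` and `y0, y1`
of two degree-`+1` operators `x, y`, degree-`−1` operators `i, j` (components `i1 : M1 → M0`,
`i2 : M2 → M1`, `i3 : M3 → M2`, likewise `j`) with the level-1 components of the CAR-type relations
`{x,i} = 1`, `{y,j} = 1` and the level-0 component of `{x,j} = 0`, and two degree-`+1` operators
`p, q` (components on levels 1, 2) with `{p,i} = α`, `{p,j} = β`, `{q,i} = γ`, `{q,j} = δ`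
(scalars) on levels 2 and 3 — exactly the hypotheses the proof uses. Conclusion: the `M1 → M3` block of the anticommutator `{p,q}` vanishes:
`q2 ∘ p1 + p2 ∘ q1 = 0`. Proof: with `S := q2 ∘ p1 + p2 ∘ q1` one has `S ∘ i2 = 0` and
`S ∘ j2 = 0` (the scalar terms cancel), hence `S = S ∘ (x0 ∘ i1) = S ∘ (y0 ∘ j1)` from the level-1
relations, and `(y0 ∘ j1) ∘ (x0 ∘ i1) = 0` because `j1 ∘ x0 = 0`. [th-3 g41] -/
theorem anticomm_upper_eq_zero
    (x0 y0 : M0 →ₗ[R] M1) (x1 y1 p1 q1 : M1 →ₗ[R] M2) (p2 q2 : M2 →ₗ[R] M3)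
    (i1 j1 : M1 →ₗ[R] M0) (i2 j2 : M2 →ₗ[R] M1) (i3 j3 : M3 →ₗ[R] M2) (α β γ δ : R)
    -- the level-1 components of {x,i} = 1 and {y,j} = 1, and the level-0 component of {x,j} = 0
    (hxi1 : x0 ∘ₗ i1 + i2 ∘ₗ x1 = LinearMap.id) (hyj1 : y0 ∘ₗ j1 + j2 ∘ₗ y1 = LinearMap.id)
    (hxj0 : j1 ∘ₗ x0 = 0)
    -- {p,i} = α, {p,j} = β, {q,i} = γ, {q,j} = δ on levels 2 and 3
    (hpi2 : p1 ∘ₗ i2 + i3 ∘ₗ p2 = α • LinearMap.id) (hpi3 : p2 ∘ₗ i3 = α • LinearMap.id)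
    (hpj2 : p1 ∘ₗ j2 + j3 ∘ₗ p2 = β • LinearMap.id) (hpj3 : p2 ∘ₗ j3 = β • LinearMap.id)
    (hqi2 : q1 ∘ₗ i2 + i3 ∘ₗ q2 = γ • LinearMap.id) (hqi3 : q2 ∘ₗ i3 = γ • LinearMap.id)
    (hqj2 : q1 ∘ₗ j2 + j3 ∘ₗ q2 = δ • LinearMap.id) (hqj3 : q2 ∘ₗ j3 = δ • LinearMap.id) :
    q2 ∘ₗ p1 + p2 ∘ₗ q1 = 0 := by
  -- S ∘ i2 = 0
  have hp1i2 : p1 ∘ₗ i2 = α • LinearMap.id - i3 ∘ₗ p2 := eq_sub_of_add_eq hpi2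
  have hq1i2 : q1 ∘ₗ i2 = γ • LinearMap.id - i3 ∘ₗ q2 := eq_sub_of_add_eq hqi2
  have hp1j2 : p1 ∘ₗ j2 = β • LinearMap.id - j3 ∘ₗ p2 := eq_sub_of_add_eq hpj2
  have hq1j2 : q1 ∘ₗ j2 = δ • LinearMap.id - j3 ∘ₗ q2 := eq_sub_of_add_eq hqj2
  have Si : (q2 ∘ₗ p1 + p2 ∘ₗ q1) ∘ₗ i2 = 0 := by
    rw [LinearMap.add_comp, LinearMap.comp_assoc, hp1i2, LinearMap.comp_assoc, hq1i2,
      LinearMap.comp_sub, LinearMap.comp_sub, LinearMap.comp_smul, LinearMap.comp_smul,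
      LinearMap.comp_id, LinearMap.comp_id, ← LinearMap.comp_assoc, hqi3, ← LinearMap.comp_assoc,
      hpi3, LinearMap.smul_comp, LinearMap.smul_comp, LinearMap.id_comp, LinearMap.id_comp]
    abel
  have Sj : (q2 ∘ₗ p1 + p2 ∘ₗ q1) ∘ₗ j2 = 0 := by
    rw [LinearMap.add_comp, LinearMap.comp_assoc, hp1j2, LinearMap.comp_assoc, hq1j2,
      LinearMap.comp_sub, LinearMap.comp_sub, LinearMap.comp_smul, LinearMap.comp_smul,
      LinearMap.comp_id, LinearMap.comp_id, ← LinearMap.comp_assoc, hqj3, ← LinearMap.comp_assoc,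
      hpj3, LinearMap.smul_comp, LinearMap.smul_comp, LinearMap.id_comp, LinearMap.id_comp]
    abel
  -- S = S ∘ x0 ∘ i1 and S = S ∘ y0 ∘ j1
  set S := q2 ∘ₗ p1 + p2 ∘ₗ q1 with hS
  have Sx : S = S ∘ₗ (x0 ∘ₗ i1) := by
    have h : S ∘ₗ (x0 ∘ₗ i1 + i2 ∘ₗ x1) = S := by rw [hxi1, LinearMap.comp_id]
    have h2 : S ∘ₗ (i2 ∘ₗ x1) = 0 := by rw [← LinearMap.comp_assoc, Si, LinearMap.zero_comp]
    rw [LinearMap.comp_add, h2, add_zero] at h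
    exact h.symm
  have Sy : S = S ∘ₗ (y0 ∘ₗ j1) := by
    have h : S ∘ₗ (y0 ∘ₗ j1 + j2 ∘ₗ y1) = S := by rw [hyj1, LinearMap.comp_id]
    have h2 : S ∘ₗ (j2 ∘ₗ y1) = 0 := by rw [← LinearMap.comp_assoc, Sj, LinearMap.zero_comp]
    rw [LinearMap.comp_add, h2, add_zero] at h
    exact h.symm
  -- (y0 ∘ j1) ∘ (x0 ∘ i1) = 0
  have P : (y0 ∘ₗ j1) ∘ₗ (x0 ∘ₗ i1) = 0 := by
    have h3 : j1 ∘ₗ (x0 ∘ₗ i1) = 0 := by rw [← LinearMap.comp_assoc, hxj0, LinearMap.zero_comp]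
    rw [LinearMap.comp_assoc, h3, LinearMap.comp_zero]
  have fin : S = S ∘ₗ ((y0 ∘ₗ j1) ∘ₗ (x0 ∘ₗ i1)) := by
    rw [← LinearMap.comp_assoc, ← Sy]; exact Sx
  rw [P, LinearMap.comp_zero] at fin
  exact fin

/-- **Master lemma, lower block.** Same data, now with the level-0 components `p0, q0` and the
level-0∕1 relations (`i1 ∘ x0 = 1`, `{p,i} = α` and `{q,i} = γ` on level 1). Conclusion: the
`M0 → M2` block of `{p,q}` vanishes, `q1 ∘ p0 + p1 ∘ q0 = 0`. Proof: `S⁰ = S⁰ ∘ i1 ∘ x0` and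
`S⁰ ∘ i1 = i3 ∘ (q2 ∘ p1 + p2 ∘ q1) = 0` by the upper block. [th-3 g41] -/
theorem anticomm_lower_eq_zero
    (x0 y0 p0 q0 : M0 →ₗ[R] M1) (x1 y1 p1 q1 : M1 →ₗ[R] M2) (p2 q2 : M2 →ₗ[R] M3)
    (i1 j1 : M1 →ₗ[R] M0) (i2 j2 : M2 →ₗ[R] M1) (i3 j3 : M3 →ₗ[R] M2) (α β γ δ : R)
    (hxi0 : i1 ∘ₗ x0 = LinearMap.id)
    (hxi1 : x0 ∘ₗ i1 + i2 ∘ₗ x1 = LinearMap.id) (hyj1 : y0 ∘ₗ j1 + j2 ∘ₗ y1 = LinearMap.id)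
    (hxj0 : j1 ∘ₗ x0 = 0)
    (hpi1 : p0 ∘ₗ i1 + i2 ∘ₗ p1 = α • LinearMap.id) (hqi1 : q0 ∘ₗ i1 + i2 ∘ₗ q1 = γ • LinearMap.id)
    (hpi2 : p1 ∘ₗ i2 + i3 ∘ₗ p2 = α • LinearMap.id) (hpi3 : p2 ∘ₗ i3 = α • LinearMap.id)
    (hpj2 : p1 ∘ₗ j2 + j3 ∘ₗ p2 = β • LinearMap.id) (hpj3 : p2 ∘ₗ j3 = β • LinearMap.id)
    (hqi2 : q1 ∘ₗ i2 + i3 ∘ₗ q2 = γ • LinearMap.id) (hqi3 : q2 ∘ₗ i3 = γ • LinearMap.id)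
    (hqj2 : q1 ∘ₗ j2 + j3 ∘ₗ q2 = δ • LinearMap.id) (hqj3 : q2 ∘ₗ j3 = δ • LinearMap.id) :
    q1 ∘ₗ p0 + p1 ∘ₗ q0 = 0 := by
  have up : q2 ∘ₗ p1 + p2 ∘ₗ q1 = 0 :=
    anticomm_upper_eq_zero x0 y0 x1 y1 p1 q1 p2 q2 i1 j1 i2 j2 i3 j3 α β γ δ hxi1 hyj1 hxj0
      hpi2 hpi3 hpj2 hpj3 hqi2 hqi3 hqj2 hqj3
  have hp0i1 : p0 ∘ₗ i1 = α • LinearMap.id - i2 ∘ₗ p1 := eq_sub_of_add_eq hpi1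
  have hq0i1 : q0 ∘ₗ i1 = γ • LinearMap.id - i2 ∘ₗ q1 := eq_sub_of_add_eq hqi1
  have hp1i2 : p1 ∘ₗ i2 = α • LinearMap.id - i3 ∘ₗ p2 := eq_sub_of_add_eq hpi2
  have hq1i2 : q1 ∘ₗ i2 = γ • LinearMap.id - i3 ∘ₗ q2 := eq_sub_of_add_eq hqi2
  set S := q1 ∘ₗ p0 + p1 ∘ₗ q0 with hS
  -- S ∘ i1 = i3 ∘ (upper block) = 0
  have e1 : q1 ∘ₗ (p0 ∘ₗ i1) = α • q1 - γ • p1 + i3 ∘ₗ (q2 ∘ₗ p1) := by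
    rw [hp0i1, LinearMap.comp_sub, LinearMap.comp_smul, LinearMap.comp_id, ← LinearMap.comp_assoc,
      hq1i2, LinearMap.sub_comp, LinearMap.smul_comp, LinearMap.id_comp, LinearMap.comp_assoc]
    abel
  have e2 : p1 ∘ₗ (q0 ∘ₗ i1) = γ • p1 - α • q1 + i3 ∘ₗ (p2 ∘ₗ q1) := by
    rw [hq0i1, LinearMap.comp_sub, LinearMap.comp_smul, LinearMap.comp_id, ← LinearMap.comp_assoc,
      hp1i2, LinearMap.sub_comp, LinearMap.smul_comp, LinearMap.id_comp, LinearMap.comp_assoc]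
    abel
  have Si : S ∘ₗ i1 = 0 := by
    have e : S ∘ₗ i1 = i3 ∘ₗ (q2 ∘ₗ p1 + p2 ∘ₗ q1) := by
      rw [hS, LinearMap.add_comp, LinearMap.comp_assoc, LinearMap.comp_assoc, e1, e2,
        LinearMap.comp_add]
      abel
    rw [e, up, LinearMap.comp_zero]
  have fin : S = S ∘ₗ (i1 ∘ₗ x0) := by rw [hxi0, LinearMap.comp_id]
  rw [← LinearMap.comp_assoc, Si, LinearMap.zero_comp] at fin
  exact fin

/-- **Corollary (the CAR pair anticommutes).** If `x, y` (degree `+1`) admit `i, j` (degree `−1`)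
with `{x,i} = 1`, `{y,j} = 1`, `{x,j} = 0`, `{y,i} = 0` on the four levels, then `{x,y} = 0`:
both blocks `y1 ∘ x0 + x1 ∘ y0` and `y2 ∘ x1 + x2 ∘ y1` vanish (master lemma with
`(α,β,γ,δ) = (1,0,0,1)`). In the cell's language: one identity-type Killing class `e₃ ⊗ Id`
(which supplies `ι₁ = −V₂`, `ι₂ = V₁`) forces `{u₁,u₂} = 0`. [th-3 g41] -/
theorem anticomm_pair_eq_zero
    (x0 y0 : M0 →ₗ[R] M1) (x1 y1 : M1 →ₗ[R] M2) (x2 y2 : M2 →ₗ[R] M3)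
    (i1 j1 : M1 →ₗ[R] M0) (i2 j2 : M2 →ₗ[R] M1) (i3 j3 : M3 →ₗ[R] M2)
    (hxi0 : i1 ∘ₗ x0 = LinearMap.id) (hxi1 : x0 ∘ₗ i1 + i2 ∘ₗ x1 = LinearMap.id)
    (hxi2 : x1 ∘ₗ i2 + i3 ∘ₗ x2 = LinearMap.id) (hxi3 : x2 ∘ₗ i3 = LinearMap.id)
    (hyj1 : y0 ∘ₗ j1 + j2 ∘ₗ y1 = LinearMap.id)
    (hyj2 : y1 ∘ₗ j2 + j3 ∘ₗ y2 = LinearMap.id) (hyj3 : y2 ∘ₗ j3 = LinearMap.id)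
    (hxj0 : j1 ∘ₗ x0 = 0) (hxj2 : x1 ∘ₗ j2 + j3 ∘ₗ x2 = 0) (hxj3 : x2 ∘ₗ j3 = 0)
    (hyi1 : y0 ∘ₗ i1 + i2 ∘ₗ y1 = 0) (hyi2 : y1 ∘ₗ i2 + i3 ∘ₗ y2 = 0) (hyi3 : y2 ∘ₗ i3 = 0) :
    y1 ∘ₗ x0 + x1 ∘ₗ y0 = 0 ∧ y2 ∘ₗ x1 + x2 ∘ₗ y1 = 0 := by
  refine ⟨?_, ?_⟩
  · exact anticomm_lower_eq_zero x0 y0 x0 y0 x1 y1 x1 y1 x2 y2 i1 j1 i2 j2 i3 j3 1 0 0 1 hxi0 hxi1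
      hyj1 hxj0 (by rw [one_smul]; exact hxi1) (by rw [zero_smul]; exact hyi1)
      (by rw [one_smul]; exact hxi2) (by rw [one_smul]; exact hxi3)
      (by rw [zero_smul]; exact hxj2) (by rw [zero_smul]; exact hxj3)
      (by rw [zero_smul]; exact hyi2) (by rw [zero_smul]; exact hyi3)
      (by rw [one_smul]; exact hyj2) (by rw [one_smul]; exact hyj3)
  · exact anticomm_upper_eq_zero x0 y0 x1 y1 x1 y1 x2 y2 i1 j1 i2 j2 i3 j3 1 0 0 1 hxi1 hyj1 hxj0
      (by rw [one_smul]; exact hxi2) (by rw [one_smul]; exact hxi3)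
      (by rw [zero_smul]; exact hxj2) (by rw [zero_smul]; exact hxj3)
      (by rw [zero_smul]; exact hyi2) (by rw [zero_smul]; exact hyi3)
      (by rw [one_smul]; exact hyj2) (by rw [one_smul]; exact hyj3)

/-- **Squares vanish (upper block).** For ONE degree-`+1` operator `p` with `{p,i} = α`,
`{p,j} = β` (scalars) on levels 2 and 3, and the level-1 CAR data of `x, y, i, j` as above:
`p2 ∘ p1 = 0`. (With `p = x`: `α = 1, β = 0`; with a transversal direction: `α = β = 0`.) So the
flatness conclusion includes `u_a ∘ u_a = 0` with no assumption on the characteristic.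
[th-3 g41] -/
theorem sq_upper_eq_zero
    (x0 y0 : M0 →ₗ[R] M1) (x1 y1 p1 : M1 →ₗ[R] M2) (p2 : M2 →ₗ[R] M3)
    (i1 j1 : M1 →ₗ[R] M0) (i2 j2 : M2 →ₗ[R] M1) (i3 j3 : M3 →ₗ[R] M2) (α β : R)
    (hxi1 : x0 ∘ₗ i1 + i2 ∘ₗ x1 = LinearMap.id) (hyj1 : y0 ∘ₗ j1 + j2 ∘ₗ y1 = LinearMap.id)
    (hxj0 : j1 ∘ₗ x0 = 0)
    (hpi2 : p1 ∘ₗ i2 + i3 ∘ₗ p2 = α • LinearMap.id) (hpi3 : p2 ∘ₗ i3 = α • LinearMap.id)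
    (hpj2 : p1 ∘ₗ j2 + j3 ∘ₗ p2 = β • LinearMap.id) (hpj3 : p2 ∘ₗ j3 = β • LinearMap.id) :
    p2 ∘ₗ p1 = 0 := by
  have hp1i2 : p1 ∘ₗ i2 = α • LinearMap.id - i3 ∘ₗ p2 := eq_sub_of_add_eq hpi2
  have hp1j2 : p1 ∘ₗ j2 = β • LinearMap.id - j3 ∘ₗ p2 := eq_sub_of_add_eq hpj2
  set S := p2 ∘ₗ p1 with hS
  have Si : S ∘ₗ i2 = 0 := by
    rw [hS, LinearMap.comp_assoc, hp1i2, LinearMap.comp_sub, LinearMap.comp_smul, LinearMap.comp_id,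
      ← LinearMap.comp_assoc, hpi3, LinearMap.smul_comp, LinearMap.id_comp, sub_self]
  have Sj : S ∘ₗ j2 = 0 := by
    rw [hS, LinearMap.comp_assoc, hp1j2, LinearMap.comp_sub, LinearMap.comp_smul, LinearMap.comp_id,
      ← LinearMap.comp_assoc, hpj3, LinearMap.smul_comp, LinearMap.id_comp, sub_self]
  have Sx : S = S ∘ₗ (x0 ∘ₗ i1) := by
    have h : S ∘ₗ (x0 ∘ₗ i1 + i2 ∘ₗ x1) = S := by rw [hxi1, LinearMap.comp_id]
    have h2 : S ∘ₗ (i2 ∘ₗ x1) = 0 := by rw [← LinearMap.comp_assoc, Si, LinearMap.zero_comp]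
    rw [LinearMap.comp_add, h2, add_zero] at h
    exact h.symm
  have Sy : S = S ∘ₗ (y0 ∘ₗ j1) := by
    have h : S ∘ₗ (y0 ∘ₗ j1 + j2 ∘ₗ y1) = S := by rw [hyj1, LinearMap.comp_id]
    have h2 : S ∘ₗ (j2 ∘ₗ y1) = 0 := by rw [← LinearMap.comp_assoc, Sj, LinearMap.zero_comp]
    rw [LinearMap.comp_add, h2, add_zero] at h
    exact h.symm
  have P : (y0 ∘ₗ j1) ∘ₗ (x0 ∘ₗ i1) = 0 := by
    have h3 : j1 ∘ₗ (x0 ∘ₗ i1) = 0 := by rw [← LinearMap.comp_assoc, hxj0, LinearMap.zero_comp]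
    rw [LinearMap.comp_assoc, h3, LinearMap.comp_zero]
  have fin : S = S ∘ₗ ((y0 ∘ₗ j1) ∘ₗ (x0 ∘ₗ i1)) := by
    rw [← LinearMap.comp_assoc, ← Sy]; exact Sx
  rw [P, LinearMap.comp_zero] at fin
  exact fin

/-- **Squares vanish (lower block).** Same data plus the level-0∕1 relations: `p1 ∘ p0 = 0`.
Proof: `p1 ∘ p0 = (p1 ∘ p0 ∘ i1) ∘ x0` and `p1 ∘ p0 ∘ i1 = i3 ∘ p2 ∘ p1 = 0`. [th-3 g41] -/
theorem sq_lower_eq_zero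
    (x0 y0 p0 : M0 →ₗ[R] M1) (x1 y1 p1 : M1 →ₗ[R] M2) (p2 : M2 →ₗ[R] M3)
    (i1 j1 : M1 →ₗ[R] M0) (i2 j2 : M2 →ₗ[R] M1) (i3 j3 : M3 →ₗ[R] M2) (α β : R)
    (hxi0 : i1 ∘ₗ x0 = LinearMap.id)
    (hxi1 : x0 ∘ₗ i1 + i2 ∘ₗ x1 = LinearMap.id) (hyj1 : y0 ∘ₗ j1 + j2 ∘ₗ y1 = LinearMap.id)
    (hxj0 : j1 ∘ₗ x0 = 0)
    (hpi1 : p0 ∘ₗ i1 + i2 ∘ₗ p1 = α • LinearMap.id)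
    (hpi2 : p1 ∘ₗ i2 + i3 ∘ₗ p2 = α • LinearMap.id) (hpi3 : p2 ∘ₗ i3 = α • LinearMap.id)
    (hpj2 : p1 ∘ₗ j2 + j3 ∘ₗ p2 = β • LinearMap.id) (hpj3 : p2 ∘ₗ j3 = β • LinearMap.id) :
    p1 ∘ₗ p0 = 0 := by
  have up : p2 ∘ₗ p1 = 0 :=
    sq_upper_eq_zero x0 y0 x1 y1 p1 p2 i1 j1 i2 j2 i3 j3 α β hxi1 hyj1 hxj0 hpi2 hpi3 hpj2 hpj3
  have hp0i1 : p0 ∘ₗ i1 = α • LinearMap.id - i2 ∘ₗ p1 := eq_sub_of_add_eq hpi1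
  have hp1i2 : p1 ∘ₗ i2 = α • LinearMap.id - i3 ∘ₗ p2 := eq_sub_of_add_eq hpi2
  set S := p1 ∘ₗ p0 with hS
  have e1 : p1 ∘ₗ (p0 ∘ₗ i1) = i3 ∘ₗ (p2 ∘ₗ p1) := by
    rw [hp0i1, LinearMap.comp_sub, LinearMap.comp_smul, LinearMap.comp_id, ← LinearMap.comp_assoc,
      hp1i2, LinearMap.sub_comp, LinearMap.smul_comp, LinearMap.id_comp, LinearMap.comp_assoc]
    abel
  have Si : S ∘ₗ i1 = 0 := by
    rw [hS, LinearMap.comp_assoc, e1, up, LinearMap.comp_zero]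
  have fin : S = S ∘ₗ (i1 ∘ₗ x0) := by rw [hxi0, LinearMap.comp_id]
  rw [← LinearMap.comp_assoc, Si, LinearMap.zero_comp] at fin
  exact fin

/-- **The cell-facing statement: one identity-type Killing class ⇒ flat.** Three degree-`+1`
operators `u = u₁, v = u₂, w = u₃` (components on the four levels) and the two potentials `V₁, V₂`
of a Killing class with `B₃ = Id, B₁ = B₂ = 0` in the frame `s = e₃`, i.e. (E1) level by level:
`{u₂,V₁} = Id`, `{u₁,V₁} = 0`, `{u₃,V₁} = 0`, `{u₁,V₂} = −Id`, `{u₂,V₂} = 0`, `{u₃,V₂} = 0`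
(here `a1,a2,a3` are the components of `V₁` and `b1,b2,b3` those of `V₂`; `V₃` plays no role and
(E2) is automatic). Conclusion: all six products on both blocks vanish — `u₁², u₂², u₃², {u₁,u₂},
{u₁,u₃}, {u₂,u₃}` — i.e. the four-level pencil is FLAT. (Apply the master lemmas with
`x = u₂, i = V₁`, `y = u₁, j = −V₂`.) [th-3 g41] -/
theorem flat_of_identityClass
    (u0 v0 w0 : M0 →ₗ[R] M1) (u1 v1 w1 : M1 →ₗ[R] M2) (u2 v2 w2 : M2 →ₗ[R] M3)
    (a1 b1 : M1 →ₗ[R] M0) (a2 b2 : M2 →ₗ[R] M1) (a3 b3 : M3 →ₗ[R] M2)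
    -- {u₂, V₁} = Id
    (hva0 : a1 ∘ₗ v0 = LinearMap.id) (hva1 : v0 ∘ₗ a1 + a2 ∘ₗ v1 = LinearMap.id)
    (hva2 : v1 ∘ₗ a2 + a3 ∘ₗ v2 = LinearMap.id) (hva3 : v2 ∘ₗ a3 = LinearMap.id)
    -- {u₁, V₁} = 0 (levels 1–3; the level-0 component is not needed), {u₃, V₁} = 0 (levels 1–3)
    (hua1 : u0 ∘ₗ a1 + a2 ∘ₗ u1 = 0) (hua2 : u1 ∘ₗ a2 + a3 ∘ₗ u2 = 0) (hua3 : u2 ∘ₗ a3 = 0)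
    (hwa1 : w0 ∘ₗ a1 + a2 ∘ₗ w1 = 0) (hwa2 : w1 ∘ₗ a2 + a3 ∘ₗ w2 = 0) (hwa3 : w2 ∘ₗ a3 = 0)
    -- {u₁, V₂} = −Id
    (hub0 : b1 ∘ₗ u0 = -LinearMap.id) (hub1 : u0 ∘ₗ b1 + b2 ∘ₗ u1 = -LinearMap.id)
    (hub2 : u1 ∘ₗ b2 + b3 ∘ₗ u2 = -LinearMap.id) (hub3 : u2 ∘ₗ b3 = -LinearMap.id)
    -- {u₂, V₂} = 0, {u₃, V₂} = 0
    (hvb0 : b1 ∘ₗ v0 = 0) (hvb1 : v0 ∘ₗ b1 + b2 ∘ₗ v1 = 0) (hvb2 : v1 ∘ₗ b2 + b3 ∘ₗ v2 = 0) (hvb3 : v2 ∘ₗ b3 = 0)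
    (hwb1 : w0 ∘ₗ b1 + b2 ∘ₗ w1 = 0) (hwb2 : w1 ∘ₗ b2 + b3 ∘ₗ w2 = 0) (hwb3 : w2 ∘ₗ b3 = 0) :
    (u1 ∘ₗ u0 = 0 ∧ u2 ∘ₗ u1 = 0) ∧ (v1 ∘ₗ v0 = 0 ∧ v2 ∘ₗ v1 = 0) ∧ (w1 ∘ₗ w0 = 0 ∧ w2 ∘ₗ w1 = 0) ∧
    (v1 ∘ₗ u0 + u1 ∘ₗ v0 = 0 ∧ v2 ∘ₗ u1 + u2 ∘ₗ v1 = 0) ∧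
    (w1 ∘ₗ u0 + u1 ∘ₗ w0 = 0 ∧ w2 ∘ₗ u1 + u2 ∘ₗ w1 = 0) ∧
    (w1 ∘ₗ v0 + v1 ∘ₗ w0 = 0 ∧ w2 ∘ₗ v1 + v2 ∘ₗ w1 = 0) := by
  -- the CAR data: x := u₂ with i := V₁ ; y := u₁ with j := −V₂
  set j1 : M1 →ₗ[R] M0 := -b1 with hj1
  set j2 : M2 →ₗ[R] M1 := -b2 with hj2
  set j3 : M3 →ₗ[R] M2 := -b3 with hj3
  have hyj0 : j1 ∘ₗ u0 = LinearMap.id := by rw [hj1, LinearMap.neg_comp, hub0, neg_neg]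
  have hyj1 : u0 ∘ₗ j1 + j2 ∘ₗ u1 = LinearMap.id := by
    rw [hj1, hj2, LinearMap.comp_neg, LinearMap.neg_comp, ← neg_add, hub1, neg_neg]
  have hyj2 : u1 ∘ₗ j2 + j3 ∘ₗ u2 = LinearMap.id := by
    rw [hj2, hj3, LinearMap.comp_neg, LinearMap.neg_comp, ← neg_add, hub2, neg_neg]
  have hyj3 : u2 ∘ₗ j3 = LinearMap.id := by rw [hj3, LinearMap.comp_neg, hub3, neg_neg]
  have hxj0 : j1 ∘ₗ v0 = 0 := by rw [hj1, LinearMap.neg_comp, hvb0, neg_zero]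
  have hxj1 : v0 ∘ₗ j1 + j2 ∘ₗ v1 = 0 := by
    rw [hj1, hj2, LinearMap.comp_neg, LinearMap.neg_comp, ← neg_add, hvb1, neg_zero]
  have hxj2 : v1 ∘ₗ j2 + j3 ∘ₗ v2 = 0 := by
    rw [hj2, hj3, LinearMap.comp_neg, LinearMap.neg_comp, ← neg_add, hvb2, neg_zero]
  have hxj3 : v2 ∘ₗ j3 = 0 := by rw [hj3, LinearMap.comp_neg, hvb3, neg_zero]
  have hwj1 : w0 ∘ₗ j1 + j2 ∘ₗ w1 = 0 := by
    rw [hj1, hj2, LinearMap.comp_neg, LinearMap.neg_comp, ← neg_add, hwb1, neg_zero]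
  have hwj2 : w1 ∘ₗ j2 + j3 ∘ₗ w2 = 0 := by
    rw [hj2, hj3, LinearMap.comp_neg, LinearMap.neg_comp, ← neg_add, hwb2, neg_zero]
  have hwj3 : w2 ∘ₗ j3 = 0 := by rw [hj3, LinearMap.comp_neg, hwb3, neg_zero]
  refine ⟨⟨?_, ?_⟩, ⟨?_, ?_⟩, ⟨?_, ?_⟩, ⟨?_, ?_⟩, ⟨?_, ?_⟩, ⟨?_, ?_⟩⟩
  -- u₁ = y : scalars (0,1) w.r.t. (i,j)
  · exact sq_lower_eq_zero v0 u0 u0 v1 u1 u1 u2 a1 j1 a2 j2 a3 j3 0 1 hva0 hva1 hyj1 hxj0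
      (by rw [zero_smul]; exact hua1) (by rw [zero_smul]; exact hua2) (by rw [zero_smul]; exact hua3)
      (by rw [one_smul]; exact hyj2) (by rw [one_smul]; exact hyj3)
  · exact sq_upper_eq_zero v0 u0 v1 u1 u1 u2 a1 j1 a2 j2 a3 j3 0 1 hva1 hyj1 hxj0
      (by rw [zero_smul]; exact hua2) (by rw [zero_smul]; exact hua3)
      (by rw [one_smul]; exact hyj2) (by rw [one_smul]; exact hyj3)
  -- u₂ = x : scalars (1,0)
  · exact sq_lower_eq_zero v0 u0 v0 v1 u1 v1 v2 a1 j1 a2 j2 a3 j3 1 0 hva0 hva1 hyj1 hxj0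
      (by rw [one_smul]; exact hva1) (by rw [one_smul]; exact hva2) (by rw [one_smul]; exact hva3)
      (by rw [zero_smul]; exact hxj2) (by rw [zero_smul]; exact hxj3)
  · exact sq_upper_eq_zero v0 u0 v1 u1 v1 v2 a1 j1 a2 j2 a3 j3 1 0 hva1 hyj1 hxj0
      (by rw [one_smul]; exact hva2) (by rw [one_smul]; exact hva3)
      (by rw [zero_smul]; exact hxj2) (by rw [zero_smul]; exact hxj3)
  -- u₃ = w : scalars (0,0)
  · exact sq_lower_eq_zero v0 u0 w0 v1 u1 w1 w2 a1 j1 a2 j2 a3 j3 0 0 hva0 hva1 hyj1 hxj0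
      (by rw [zero_smul]; exact hwa1) (by rw [zero_smul]; exact hwa2) (by rw [zero_smul]; exact hwa3)
      (by rw [zero_smul]; exact hwj2) (by rw [zero_smul]; exact hwj3)
  · exact sq_upper_eq_zero v0 u0 v1 u1 w1 w2 a1 j1 a2 j2 a3 j3 0 0 hva1 hyj1 hxj0
      (by rw [zero_smul]; exact hwa2) (by rw [zero_smul]; exact hwa3)
      (by rw [zero_smul]; exact hwj2) (by rw [zero_smul]; exact hwj3)
  -- {u₁,u₂}: p = u (0,1), q = v (1,0)
  · exact anticomm_lower_eq_zero v0 u0 u0 v0 v1 u1 u1 v1 u2 v2 a1 j1 a2 j2 a3 j3 0 1 1 0 hva0 hva1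
      hyj1 hxj0 (by rw [zero_smul]; exact hua1) (by rw [one_smul]; exact hva1)
      (by rw [zero_smul]; exact hua2) (by rw [zero_smul]; exact hua3)
      (by rw [one_smul]; exact hyj2) (by rw [one_smul]; exact hyj3)
      (by rw [one_smul]; exact hva2) (by rw [one_smul]; exact hva3)
      (by rw [zero_smul]; exact hxj2) (by rw [zero_smul]; exact hxj3)
  · exact anticomm_upper_eq_zero v0 u0 v1 u1 u1 v1 u2 v2 a1 j1 a2 j2 a3 j3 0 1 1 0 hva1 hyj1 hxj0
      (by rw [zero_smul]; exact hua2) (by rw [zero_smul]; exact hua3)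
      (by rw [one_smul]; exact hyj2) (by rw [one_smul]; exact hyj3)
      (by rw [one_smul]; exact hva2) (by rw [one_smul]; exact hva3)
      (by rw [zero_smul]; exact hxj2) (by rw [zero_smul]; exact hxj3)
  -- {u₁,u₃}: p = u (0,1), q = w (0,0)
  · exact anticomm_lower_eq_zero v0 u0 u0 w0 v1 u1 u1 w1 u2 w2 a1 j1 a2 j2 a3 j3 0 1 0 0 hva0 hva1
      hyj1 hxj0 (by rw [zero_smul]; exact hua1) (by rw [zero_smul]; exact hwa1)
      (by rw [zero_smul]; exact hua2) (by rw [zero_smul]; exact hua3)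
      (by rw [one_smul]; exact hyj2) (by rw [one_smul]; exact hyj3)
      (by rw [zero_smul]; exact hwa2) (by rw [zero_smul]; exact hwa3)
      (by rw [zero_smul]; exact hwj2) (by rw [zero_smul]; exact hwj3)
  · exact anticomm_upper_eq_zero v0 u0 v1 u1 u1 w1 u2 w2 a1 j1 a2 j2 a3 j3 0 1 0 0 hva1 hyj1 hxj0
      (by rw [zero_smul]; exact hua2) (by rw [zero_smul]; exact hua3)
      (by rw [one_smul]; exact hyj2) (by rw [one_smul]; exact hyj3)
      (by rw [zero_smul]; exact hwa2) (by rw [zero_smul]; exact hwa3)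
      (by rw [zero_smul]; exact hwj2) (by rw [zero_smul]; exact hwj3)
  -- {u₂,u₃}: p = v (1,0), q = w (0,0)
  · exact anticomm_lower_eq_zero v0 u0 v0 w0 v1 u1 v1 w1 v2 w2 a1 j1 a2 j2 a3 j3 1 0 0 0 hva0 hva1
      hyj1 hxj0 (by rw [one_smul]; exact hva1) (by rw [zero_smul]; exact hwa1)
      (by rw [one_smul]; exact hva2) (by rw [one_smul]; exact hva3)
      (by rw [zero_smul]; exact hxj2) (by rw [zero_smul]; exact hxj3)
      (by rw [zero_smul]; exact hwa2) (by rw [zero_smul]; exact hwa3)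
      (by rw [zero_smul]; exact hwj2) (by rw [zero_smul]; exact hwj3)
  · exact anticomm_upper_eq_zero v0 u0 v1 u1 v1 w1 v2 w2 a1 j1 a2 j2 a3 j3 1 0 0 0 hva1 hyj1 hxj0
      (by rw [one_smul]; exact hva2) (by rw [one_smul]; exact hva3)
      (by rw [zero_smul]; exact hxj2) (by rw [zero_smul]; exact hxj3)
      (by rw [zero_smul]; exact hwa2) (by rw [zero_smul]; exact hwa3)
      (by rw [zero_smul]; exact hwj2) (by rw [zero_smul]; exact hwj3)

/-! ### The Euler characteristic of a four-level space carrying one contraction -/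

section EulerCharacteristic

variable {F : Type*} [Field F]
variable {N0 N1 N2 N3 : Type*} [AddCommGroup N0] [Module F N0] [FiniteDimensional F N0]
  [AddCommGroup N1] [Module F N1] [FiniteDimensional F N1] [AddCommGroup N2] [Module F N2]
  [FiniteDimensional F N2] [AddCommGroup N3] [Module F N3] [FiniteDimensional F N3]

/-- **One contraction kills the Euler characteristic.** If a degree-`+1` operator `v` (components
`v0, v1, v2`) and a degree-`−1` operator `a` (components `a1, a2, a3`) on four finite-dimensional
levels satisfy `{v, a} = Id` level by level, then `dim N0 − dim N1 + dim N2 − dim N3 = 0` (as an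
element of the field). This is the supertrace of the relation (`str {v,a} = 0` because `v, a` are
odd); here it is proved with `trace (f ∘ g) = trace (g ∘ f)` across levels. In the cell's language:
a configuration (or a summand `N`) carrying an identity-type Killing class has `sdim = 0`, so the
scalar part `λ·π_N` of a triple product `T` contributes `λ·sdim N = 0` to `str T`. [th-3 g41] -/
theorem euler_char_eq_zero_of_contraction
    (v0 : N0 →ₗ[F] N1) (v1 : N1 →ₗ[F] N2) (v2 : N2 →ₗ[F] N3)
    (a1 : N1 →ₗ[F] N0) (a2 : N2 →ₗ[F] N1) (a3 : N3 →ₗ[F] N2)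
    (h0 : a1 ∘ₗ v0 = LinearMap.id) (h1 : v0 ∘ₗ a1 + a2 ∘ₗ v1 = LinearMap.id)
    (h2 : v1 ∘ₗ a2 + a3 ∘ₗ v2 = LinearMap.id) (h3 : v2 ∘ₗ a3 = LinearMap.id) :
    (Module.finrank F N0 : F) - (Module.finrank F N1 : F) + (Module.finrank F N2 : F)
      - (Module.finrank F N3 : F) = 0 := by
  have t0 : (Module.finrank F N0 : F) = LinearMap.trace F N0 (a1 ∘ₗ v0) := by
    rw [h0, LinearMap.trace_id]
  have t1 : (Module.finrank F N1 : F) =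
      LinearMap.trace F N1 (v0 ∘ₗ a1) + LinearMap.trace F N1 (a2 ∘ₗ v1) := by
    rw [← map_add, h1, LinearMap.trace_id]
  have t2 : (Module.finrank F N2 : F) =
      LinearMap.trace F N2 (v1 ∘ₗ a2) + LinearMap.trace F N2 (a3 ∘ₗ v2) := by
    rw [← map_add, h2, LinearMap.trace_id]
  have t3 : (Module.finrank F N3 : F) = LinearMap.trace F N3 (v2 ∘ₗ a3) := by
    rw [h3, LinearMap.trace_id]
  have c01 : LinearMap.trace F N1 (v0 ∘ₗ a1) = LinearMap.trace F N0 (a1 ∘ₗ v0) :=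
    (LinearMap.trace_comp_comm' v0 a1).symm
  have c12 : LinearMap.trace F N2 (v1 ∘ₗ a2) = LinearMap.trace F N1 (a2 ∘ₗ v1) :=
    (LinearMap.trace_comp_comm' v1 a2).symm
  have c23 : LinearMap.trace F N3 (v2 ∘ₗ a3) = LinearMap.trace F N2 (a3 ∘ₗ v2) :=
    (LinearMap.trace_comp_comm' v2 a3).symm
  rw [t0, t1, t2, t3, c01, c12, c23]
  ring

end EulerCharacteristic

end Summit.Ventures.HSemireg.IdentityClassRigidity
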